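import Mathlib.Tactic.Linarith
import Mathlib.Data.Finset.Max
import Summits.ValiantsHypothesis.ValiantsHypothesis.Theorems.KPlusLogSqLawTropicalBMatchingStability

/-!
# Route «KPlusLogSqLaw», crux `TropicalB` (stmt-ValiantsHypothesis-19771) — NESTING OF MINIMUM-COST `k`-MATCHINGS AND MONOTONE
# COMPARATIVE STATICS OF ONE PARAMETRIC LEVEL

HONEST FRAMING.  Helper toward the registered stubs `stub_tropThin` / `stub_tropFat` of `Cruxes/TropicalB/Lines/birth.lean`
(crux `Summit.ValiantsHypothesis.ValiantsHypothesis.Theses.KPlusLogSqLaw.TropicalB`, item stmt-ValiantsHypothesis-19771, route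
KPlusLogSqLaw; cell `pub-symmetroid`, seat val-sym-trop-p1 g8, 2026-08-27; `--supports … --as helper`).  A COMBINATORIAL ENGINE;
nothing here bounds `TropicalB` or bears on `WeakLifting`, DoorA26 / DoorA34, `MatrixDescartes` (stmt-ValiantsHypothesis-18050) or
VP ≠ VNP.

THE POINT.  One level of the lexicographic tower of a separated dominance design (seat memo SEPARATED-LEVELS-g8.md) is the parametric
problem «minimise `Σ_{e∈M} u e − θ·|M|` over all matchings `M` inside the level's edge set `G`».  This file supplies the θ-DYNAMICS at a
fixed `G` (the vertex-deletion dynamics is …TropicalBMatchingStability):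

* `exists_minCard` — a minimum-cost `k`-matching inside `G` exists as soon as some `k`-matching does;
* `nested_succ` — **SSP NESTING**: the (unique) minimum-cost `(k+1)`-matching covers every row and column covered by a minimum-cost
  `k`-matching (successive shortest paths never un-cover a vertex) — one application of `exchange`;
* `nested` — hence, under generic costs, minimum-cost `k`- and `k'`-matchings are nested for all `k ≤ k'`;
* `card_mono_of_param` / `eq_of_param_of_card_eq` — **MONOTONE COMPARATIVE STATICS**: if `M₁` minimises at `θ₁` and `M₂` at `θ₂ > θ₁`
  then `|M₁| ≤ |M₂|`, and equal cardinalities force `M₁ = M₂` (when `M₂` is the unique minimiser); a `θ`-minimiser is a minimum-cost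
  matching of its own cardinality (`minCard_of_minParam`);
* `cover_mono_of_param` — so along increasing `θ` the optimal matching's coverage only GROWS, by exactly two vertices per unit of
  cardinality (`card_dom`/`card_rng`): the «pure threshold events add coverage» half of the memo's Lemma 4′;
* `nested_of_minParam` — TIED minimisers at one slope (an integer threshold) are nested by cardinality.

[folklore: successive shortest paths (Ford–Fulkerson / Edmonds–Karp for assignment); Murota, Discrete Convex Analysis (2003) §9]
-/

set_option linter.dupNamespace false
set_option autoImplicit false

namespace Summit.ValiantsHypothesis.ValiantsHypothesis.Theorems.KPlusLogSqLaw

namespace MatchingExchange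

open Finset
open scoped BigOperators
open Literature.Computability.MetaComplexity.PBij

variable {α β : Type*} [DecidableEq α] [DecidableEq β]

/-! ### Minimum-cost `k`-matchings: existence, nesting -/

/-- A minimum-cost `k`-matching inside `G` exists whenever some `k`-matching inside `G` exists. [folklore] -/
theorem exists_minCard {G : Finset (α × β)} {u : α × β → ℤ} {k : ℕ}
    (h : ∃ X : Finset (α × β), IsPMatching X ∧ X ⊆ G ∧ X.card = k) :
    ∃ R : Finset (α × β), IsPMatching R ∧ R ⊆ G ∧ R.card = k ∧
      ∀ X : Finset (α × β), IsPMatching X → X ⊆ G → X.card = k → ∑ e ∈ R, u e ≤ ∑ e ∈ X, u e := by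
  classical
  set S : Finset (Finset (α × β)) := G.powerset.filter (fun X => IsPMatching X ∧ X.card = k) with hS
  have hne : S.Nonempty := by
    obtain ⟨X, hX, hXG, hXk⟩ := h
    exact ⟨X, Finset.mem_filter.2 ⟨Finset.mem_powerset.2 hXG, hX, hXk⟩⟩
  obtain ⟨R, hR, hRmin⟩ := Finset.exists_min_image S (fun X => ∑ e ∈ X, u e) hne
  obtain ⟨hRG, hRm, hRk⟩ := Finset.mem_filter.1 hR
  refine ⟨R, hRm, Finset.mem_powerset.1 hRG, hRk, fun X hX hXG hXk => hRmin X ?_⟩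
  exact Finset.mem_filter.2 ⟨Finset.mem_powerset.2 hXG, hX, hXk⟩

omit [DecidableEq α] [DecidableEq β] in
/-- A matching inside `G` has sub-matchings inside `G` of every smaller cardinality. [folklore] -/
theorem exists_card_le {G X : Finset (α × β)} (hX : IsPMatching X) (hXG : X ⊆ G) {k : ℕ} (hk : k ≤ X.card) :
    ∃ Y : Finset (α × β), IsPMatching Y ∧ Y ⊆ G ∧ Y.card = k := by
  obtain ⟨Y, hYX, hYk⟩ := Finset.exists_subset_card_eq hk
  exact ⟨Y, hX.subset hYX, hYX.trans hXG, hYk⟩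

/-- **SSP NESTING (one step).**  If `R` is a minimum-cost `k`-matching inside `G` and `R'` is THE (unique) minimum-cost
`(k+1)`-matching inside `G`, then `dom R ⊆ dom R'` and `rng R ⊆ rng R'`. [folklore: successive shortest paths] -/
theorem nested_succ {G R R' : Finset (α × β)} {u : α × β → ℤ}
    (hR : IsPMatching R) (hRG : R ⊆ G)
    (hmin : ∀ X : Finset (α × β), IsPMatching X → X ⊆ G → X.card = R.card → ∑ e ∈ R, u e ≤ ∑ e ∈ X, u e)
    (hR' : IsPMatching R') (hR'G : R' ⊆ G)
    (huniq' : ∀ X : Finset (α × β), IsPMatching X → X ⊆ G → X.card = R'.card → ∑ e ∈ X, u e ≤ ∑ e ∈ R', u e → X = R')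
    (hcard : R'.card = R.card + 1) :
    dom R ⊆ dom R' ∧ rng R ⊆ rng R' := by
  obtain ⟨N₁, N₂, hN₁, hN₂, hU, hI, hc, hdom, hrng⟩ := exchange hR hR' (by omega)
  have hUG : R ∪ R' ⊆ G := Finset.union_subset hRG hR'G
  have hN₁G : N₁ ⊆ G := (subset_union_left hU).trans hUG
  have hN₂G : N₂ ⊆ G := (subset_union_right hU).trans hUG
  have hsum := wt_add_eq hU hI u
  have hcN := card_add_eq hU hI hc
  have h2 := hmin N₂ hN₂ hN₂G (by omega)
  have heq : N₁ = R' := huniq' N₁ hN₁ hN₁G (by omega) (by omega)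
  rw [heq] at hdom hrng
  exact ⟨hdom, hrng⟩

/-- **NESTING of minimum-cost matchings** under generic costs: for `k ≤ k'`, a minimum-cost `k`-matching and a minimum-cost
`k'`-matching inside `G` are nested (`dom`, `rng`), provided equal-size matchings inside `G` have distinct costs (then all minimisers
are unique). [folklore] -/
theorem nested {G : Finset (α × β)} {u : α × β → ℤ}
    (hgen : ∀ X Y : Finset (α × β), IsPMatching X → IsPMatching Y → X ⊆ G → Y ⊆ G → X.card = Y.card →
      ∑ e ∈ X, u e = ∑ e ∈ Y, u e → X = Y) :
    ∀ (n : ℕ) {R R' : Finset (α × β)}, IsPMatching R → R ⊆ G →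
      (∀ X : Finset (α × β), IsPMatching X → X ⊆ G → X.card = R.card → ∑ e ∈ R, u e ≤ ∑ e ∈ X, u e) →
      IsPMatching R' → R' ⊆ G →
      (∀ X : Finset (α × β), IsPMatching X → X ⊆ G → X.card = R'.card → ∑ e ∈ R', u e ≤ ∑ e ∈ X, u e) →
      R'.card = R.card + n → dom R ⊆ dom R' ∧ rng R ⊆ rng R' := by
  intro n
  induction n with
  | zero =>
    intro R R' hR hRG hmin hR' hR'G hmin' hcard
    have h1 := hmin R' hR' hR'G (by omega)
    have h2 := hmin' R hR hRG (by omega)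
    have : R = R' := hgen R R' hR hR' hRG hR'G (by omega) (le_antisymm h1 h2)
    subst this
    exact ⟨le_rfl, le_rfl⟩
  | succ n ih =>
    intro R R' hR hRG hmin hR' hR'G hmin' hcard
    -- an intermediate minimum-cost `(k+n)`-matching
    obtain ⟨Y, hY, hYG, hYk⟩ := exists_card_le hR' hR'G (k := R.card + n) (by omega)
    obtain ⟨S, hS, hSG, hSk, hSmin⟩ := exists_minCard (u := u) ⟨Y, hY, hYG, hYk⟩
    have h1 := ih hR hRG hmin hS hSG (fun X hX hXG hXk => hSmin X hX hXG (by omega)) (by omega)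
    have huniq' : ∀ X : Finset (α × β), IsPMatching X → X ⊆ G → X.card = R'.card →
        ∑ e ∈ X, u e ≤ ∑ e ∈ R', u e → X = R' :=
      fun X hX hXG hXk hle => hgen X R' hX hR' hXG hR'G hXk (le_antisymm hle (hmin' X hX hXG hXk))
    have h2 := nested_succ hS hSG (fun X hX hXG hXk => hSmin X hX hXG (by omega)) hR' hR'G huniq' (by omega)
    exact ⟨h1.1.trans h2.1, h1.2.trans h2.2⟩

/-! ### One parametric level: minimisers of `Σ u − θ·|M|` -/

omit [DecidableEq α] [DecidableEq β] in
/-- A minimiser of `Σ_{e∈M} u e − θ|M|` over all matchings inside `G` is a minimum-cost matching of its own cardinality. [folklore] -/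
theorem minCard_of_minParam {G M : Finset (α × β)} {u : α × β → ℤ} {θ : ℤ}
    (hmin : ∀ X : Finset (α × β), IsPMatching X → X ⊆ G →
      ∑ e ∈ M, u e - θ * (M.card : ℤ) ≤ ∑ e ∈ X, u e - θ * (X.card : ℤ)) :
    ∀ X : Finset (α × β), IsPMatching X → X ⊆ G → X.card = M.card → ∑ e ∈ M, u e ≤ ∑ e ∈ X, u e := by
  intro X hX hXG hXk
  have := hmin X hX hXG
  rw [hXk] at this
  linarith

omit [DecidableEq α] [DecidableEq β] in
/-- Uniqueness transfers likewise. [folklore] -/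
theorem uniqCard_of_uniqParam {G M : Finset (α × β)} {u : α × β → ℤ} {θ : ℤ}
    (huniq : ∀ X : Finset (α × β), IsPMatching X → X ⊆ G →
      ∑ e ∈ X, u e - θ * (X.card : ℤ) ≤ ∑ e ∈ M, u e - θ * (M.card : ℤ) → X = M) :
    ∀ X : Finset (α × β), IsPMatching X → X ⊆ G → X.card = M.card → ∑ e ∈ X, u e ≤ ∑ e ∈ M, u e → X = M := by
  intro X hX hXG hXk hle
  refine huniq X hX hXG ?_
  rw [hXk]; linarith

omit [DecidableEq α] [DecidableEq β] in
/-- **MONOTONE COMPARATIVE STATICS (cardinality).**  If `M₁` minimises `Σ u − θ₁|·|` and `M₂` minimises `Σ u − θ₂|·|` over the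
matchings inside `G`, and `θ₁ < θ₂`, then `|M₁| ≤ |M₂|`. [folklore] -/
theorem card_mono_of_param {G M₁ M₂ : Finset (α × β)} {u : α × β → ℤ} {θ₁ θ₂ : ℤ} (hθ : θ₁ < θ₂)
    (hM₁ : IsPMatching M₁) (hM₁G : M₁ ⊆ G) (hM₂ : IsPMatching M₂) (hM₂G : M₂ ⊆ G)
    (hmin₁ : ∀ X : Finset (α × β), IsPMatching X → X ⊆ G →
      ∑ e ∈ M₁, u e - θ₁ * (M₁.card : ℤ) ≤ ∑ e ∈ X, u e - θ₁ * (X.card : ℤ))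
    (hmin₂ : ∀ X : Finset (α × β), IsPMatching X → X ⊆ G →
      ∑ e ∈ M₂, u e - θ₂ * (M₂.card : ℤ) ≤ ∑ e ∈ X, u e - θ₂ * (X.card : ℤ)) :
    M₁.card ≤ M₂.card := by
  have h1 := hmin₁ M₂ hM₂ hM₂G
  have h2 := hmin₂ M₁ hM₁ hM₁G
  have h3 : (θ₂ - θ₁) * ((M₁.card : ℤ) - M₂.card) ≤ 0 := by nlinarith
  have h4 : ((M₁.card : ℤ) - M₂.card) ≤ 0 := by
    by_contra h5
    have h5' : 0 < (M₁.card : ℤ) - M₂.card := by linarith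
    have : 0 < (θ₂ - θ₁) * ((M₁.card : ℤ) - M₂.card) := mul_pos (by linarith) h5'
    linarith
  exact_mod_cast (by linarith : (M₁.card : ℤ) ≤ M₂.card)

omit [DecidableEq α] [DecidableEq β] in
/-- **MONOTONE COMPARATIVE STATICS (equality).**  If `|M₁| = |M₂|`, `M₁` minimises at `θ₁` and `M₂` is the UNIQUE minimiser at `θ₂`
(any two parameters), then `M₁ = M₂`: between two parameters the optimal matching changes only if its cardinality does. [folklore] -/
theorem eq_of_param_of_card_eq {G M₁ M₂ : Finset (α × β)} {u : α × β → ℤ} {θ₁ θ₂ : ℤ}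
    (hM₁ : IsPMatching M₁) (hM₁G : M₁ ⊆ G) (hM₂ : IsPMatching M₂) (hM₂G : M₂ ⊆ G)
    (hmin₁ : ∀ X : Finset (α × β), IsPMatching X → X ⊆ G →
      ∑ e ∈ M₁, u e - θ₁ * (M₁.card : ℤ) ≤ ∑ e ∈ X, u e - θ₁ * (X.card : ℤ))
    (huniq₂ : ∀ X : Finset (α × β), IsPMatching X → X ⊆ G →
      ∑ e ∈ X, u e - θ₂ * (X.card : ℤ) ≤ ∑ e ∈ M₂, u e - θ₂ * (M₂.card : ℤ) → X = M₂)
    (hcard : M₁.card = M₂.card) : M₁ = M₂ := by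
  have h1 := hmin₁ M₂ hM₂ hM₂G
  rw [hcard] at h1
  refine huniq₂ M₁ hM₁ hM₁G ?_
  rw [hcard]
  linarith

/-- **COVERAGE GROWS ALONG θ.**  Under generic costs, if `M₁` minimises at `θ₁` and `M₂` at `θ₂ > θ₁` (over the matchings inside the
same `G`), then `dom M₁ ⊆ dom M₂`, `rng M₁ ⊆ rng M₂`; with `card_dom`/`card_rng` the coverage grows by exactly `|M₂| − |M₁|` rows and as
many columns. [folklore] -/
theorem cover_mono_of_param {G M₁ M₂ : Finset (α × β)} {u : α × β → ℤ} {θ₁ θ₂ : ℤ} (hθ : θ₁ < θ₂)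
    (hgen : ∀ X Y : Finset (α × β), IsPMatching X → IsPMatching Y → X ⊆ G → Y ⊆ G → X.card = Y.card →
      ∑ e ∈ X, u e = ∑ e ∈ Y, u e → X = Y)
    (hM₁ : IsPMatching M₁) (hM₁G : M₁ ⊆ G) (hM₂ : IsPMatching M₂) (hM₂G : M₂ ⊆ G)
    (hmin₁ : ∀ X : Finset (α × β), IsPMatching X → X ⊆ G →
      ∑ e ∈ M₁, u e - θ₁ * (M₁.card : ℤ) ≤ ∑ e ∈ X, u e - θ₁ * (X.card : ℤ))
    (hmin₂ : ∀ X : Finset (α × β), IsPMatching X → X ⊆ G →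
      ∑ e ∈ M₂, u e - θ₂ * (M₂.card : ℤ) ≤ ∑ e ∈ X, u e - θ₂ * (X.card : ℤ)) :
    dom M₁ ⊆ dom M₂ ∧ rng M₁ ⊆ rng M₂ := by
  have hle : M₁.card ≤ M₂.card := card_mono_of_param hθ hM₁ hM₁G hM₂ hM₂G hmin₁ hmin₂
  exact nested hgen (M₂.card - M₁.card) hM₁ hM₁G (minCard_of_minParam hmin₁) hM₂ hM₂G (minCard_of_minParam hmin₂) (by omega)

/-- **TIED MINIMISERS ARE NESTED.**  Under generic costs, two minimisers of `Σ u − θ|·|` over the matchings inside the same `G` (a tie at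
an integer threshold) are nested by cardinality: the smaller one's rows and columns are covered by the larger one.  (Both are minimum-cost
matchings of their own cardinality, `minCard_of_minParam`, and those are nested, `nested`.) [folklore] -/
theorem nested_of_minParam {G M₁ M₂ : Finset (α × β)} {u : α × β → ℤ} {θ : ℤ}
    (hgen : ∀ X Y : Finset (α × β), IsPMatching X → IsPMatching Y → X ⊆ G → Y ⊆ G → X.card = Y.card →
      ∑ e ∈ X, u e = ∑ e ∈ Y, u e → X = Y)
    (hM₁ : IsPMatching M₁) (hM₁G : M₁ ⊆ G) (hM₂ : IsPMatching M₂) (hM₂G : M₂ ⊆ G)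
    (hmin₁ : ∀ X : Finset (α × β), IsPMatching X → X ⊆ G →
      ∑ e ∈ M₁, u e - θ * (M₁.card : ℤ) ≤ ∑ e ∈ X, u e - θ * (X.card : ℤ))
    (hmin₂ : ∀ X : Finset (α × β), IsPMatching X → X ⊆ G →
      ∑ e ∈ M₂, u e - θ * (M₂.card : ℤ) ≤ ∑ e ∈ X, u e - θ * (X.card : ℤ))
    (hle : M₁.card ≤ M₂.card) : dom M₁ ⊆ dom M₂ ∧ rng M₁ ⊆ rng M₂ :=
  nested hgen (M₂.card - M₁.card) hM₁ hM₁G (minCard_of_minParam hmin₁) hM₂ hM₂G (minCard_of_minParam hmin₂) (by omega)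

end MatchingExchange

end Summit.ValiantsHypothesis.ValiantsHypothesis.Theorems.KPlusLogSqLaw
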